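import Mathlib
import Literature.NumberTheory.DiophantineGeometry.SymmetricGroupRepsSignTwist
import Literature.NumberTheory.DiophantineGeometry.SymmetricGroupRepsYoungSymmetrizerNeZeroProofs
import HarnessLib

/-!
# ValiantsHypothesis / SymPencil — crux `EquivariantSdcNotQP` (stmt-ValiantsHypothesis-17792), line
# `birth_EquivariantSdcNotQP`, stub `stub_permify`, hypothesis (H2) `YoungFixedVector`: step 1 —
# YOUNG'S RULE IN THE YOUNG-SYMMETRIZER MODEL and irreducible subrepresentations

Towards an unconditional proof of hypothesis (H2) of `permEmbeddingD_of_alternatingBounds`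
(`…PermEmbeddingOfYoungBounds.lean`): every complex representation of `𝔄_n × 𝔄_n` of dimension
`k ≥ 1` has a nonzero functional fixed by a subgroup of quasi-polynomial index.  This file (helper of
the item, `--supports stmt-ValiantsHypothesis-17792 --as helper`; 0 definitions, 0 named facts) supplies,
on the tree's Specht layer (`Literature/NumberTheory/DiophantineGeometry/SymmetricGroupReps*`: Young
symmetrizer `c_μ = a_μ b_μ`, `S^μ = ℂ[𝔖_n] c_μ`, sign twist `S^{μᵗ} ≅ S^μ ⊗ sgn`):
* `of_mul_rowSymmetrizer`, `of_mul_youngSymmetrizer` — `p · a_μ = a_μ`, `p · c_μ = c_μ` for `p` in the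
  row group `R_μ`;
* `exists_fixed_rowStabilizer` — **Young's rule, multiplicity form**: `S^μ` contains a nonzero vector
  fixed by the Young subgroup `R_μ` (namely `c_μ`; James–Kerber 2.3.15 (ii) `([μ], 1↑_{𝔖_μ}) = 1`);
* `exists_fixed_rowStabilizer_transpose` — through `S^{μᵗ} ≅ S^μ ⊗ sgn`: `S^μ` contains a nonzero vector
  fixed by the EVEN elements of `R_{μᵗ}`;
* `exists_irreducible_subrepresentation` — a nonzero finite-dimensional complex representation of any
  group has an irreducible subrepresentation (one of minimal dimension).

Honest framing: classical facts; (H2), (H1), `stub_permify`, the crux `SymPencil.EquivariantSdcNotQP`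
and `VP ≠ VNP` remain OPEN here.
-/

noncomputable section

set_option linter.dupNamespace false

namespace Summit.ValiantsHypothesis.ValiantsHypothesis.Theorems.SymPencilEquivariantSdcNotQP.YoungBounds

open Literature.NumberTheory.DiophantineGeometry

/-! ### Young's rule in the Young-symmetrizer model -/

/-- The row symmetrizer absorbs row permutations on the LEFT: `p · a_μ = a_μ` for `p ∈ R_μ`
(companion of the tree's `rowSymmetrizer_mul_of`). [folklore] -/
theorem of_mul_rowSymmetrizer {k : Type*} [Field k] {d : ℕ} {μ : Nat.Partition d}
    {p : Equiv.Perm (Fin d)} (hp : p ∈ rowStabilizer μ) :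
    MonoidAlgebra.of k _ p * rowSymmetrizer k μ = rowSymmetrizer k μ := by
  classical
  unfold rowSymmetrizer
  rw [Finset.mul_sum]
  refine Finset.sum_equiv (Equiv.mulLeft p) (fun σ => ?_) (fun σ _ => ?_)
  · simp only [Equiv.coe_mulLeft, Set.mem_toFinset, SetLike.mem_coe]
    exact ⟨fun h => mul_mem hp h, fun h => by simpa using mul_mem (inv_mem hp) h⟩
  · rw [Equiv.coe_mulLeft, map_mul]

/-- `p · c_μ = c_μ` for `p` in the row group. [folklore] -/
theorem of_mul_youngSymmetrizer {k : Type*} [Field k] {d : ℕ} {μ : Nat.Partition d}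
    {p : Equiv.Perm (Fin d)} (hp : p ∈ rowStabilizer μ) :
    MonoidAlgebra.of k _ p * youngSymmetrizer k μ = youngSymmetrizer k μ := by
  rw [youngSymmetrizer, ← mul_assoc, of_mul_rowSymmetrizer hp]

/-- **Young's rule (multiplicity form, `([μ], 1↑_{𝔖_μ}^{𝔖_n}) ≥ 1`).**  The Specht module
`S^μ = ℂ[𝔖_n] c_μ` contains a nonzero vector fixed by the Young subgroup `R_μ`: the Young symmetrizer
`c_μ` itself (James–Kerber 2.3.15 (ii) / 2.8.5). [folklore] -/
theorem exists_fixed_rowStabilizer {d : ℕ} (μ : Nat.Partition d) :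
    ∃ v : spechtIdeal ℂ μ, v ≠ 0 ∧ ∀ p ∈ rowStabilizer μ, spechtRep ℂ μ p v = v := by
  refine ⟨⟨youngSymmetrizer ℂ μ, youngSymmetrizer_mem_spechtIdeal ℂ μ⟩, ?_, fun p hp => ?_⟩
  · intro h
    exact youngSymmetrizer_ne_zero_holds (k := ℂ) μ (congrArg Subtype.val h)
  · apply Subtype.ext
    rw [spechtRep_apply]
    exact of_mul_youngSymmetrizer hp

/-- A fixed vector is transported along an equivalence of representations. [folklore] -/
theorem fixed_of_equiv {G : Type*} [Monoid G] {V W : Type*} [AddCommGroup V] [Module ℂ V]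
    [AddCommGroup W] [Module ℂ W] {ρ : Representation ℂ G V} {σ : Representation ℂ G W}
    (e : ρ.Equiv σ) {v : V} {g : G} (hv : ρ g v = v) : σ g (e v) = e v := by
  have h := Representation.IntertwiningMap.isIntertwining _ _ e.toIntertwiningMap g v
  rw [hv] at h
  rw [Representation.Equiv.coe_toIntertwiningMap] at h
  exact h.symm

/-- **The transposed orientation.**  Through the isomorphism `S^{μᵗ} ≅ S^μ ⊗ sgn`
(`spechtRepTransposeEquiv`), `S^μ` contains a nonzero vector on which every EVEN element of the row
group `R_{μᵗ}` of the transposed shape acts trivially. [folklore] -/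
theorem exists_fixed_rowStabilizer_transpose {d : ℕ} (μ : Nat.Partition d) :
    ∃ v : spechtIdeal ℂ μ, v ≠ 0 ∧ ∀ p ∈ rowStabilizer μ.transpose,
      p ∈ alternatingGroup (Fin d) → spechtRep ℂ μ p v = v := by
  obtain ⟨w, hw0, hw⟩ := exists_fixed_rowStabilizer (μ.transpose)
  set e := (spechtRepTransposeEquiv ℂ μ).symm with he
  refine ⟨e w, ?_, fun p hp hpe => ?_⟩
  · intro h
    apply hw0
    have : e.symm (e w) = e.symm 0 := by rw [h]
    simpa using this
  · have h1 : signTwist ℂ (spechtRep ℂ μ) p (e w) = e w := fixed_of_equiv e (hw p hp)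
    rw [signTwist_apply, Equiv.Perm.mem_alternatingGroup.mp hpe, Units.val_one, Int.cast_one,
      one_smul] at h1
    exact h1

/-! ### Irreducible subrepresentations -/

/-- A nonzero finite-dimensional representation has an irreducible subrepresentation (a nonzero
subrepresentation of minimal dimension). [folklore] -/
theorem exists_irreducible_subrepresentation {G : Type*} [Monoid G] {W : Type*} [AddCommGroup W]
    [Module ℂ W] [FiniteDimensional ℂ W] [Nontrivial W] (π : Representation ℂ G W) :
    ∃ σ : Subrepresentation π, σ.toSubmodule ≠ ⊥ ∧ σ.toRepresentation.IsIrreducible := by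
  classical
  -- dimensions of nonzero subrepresentations
  have hex : ∃ m : ℕ, ∃ σ : Subrepresentation π, σ.toSubmodule ≠ ⊥ ∧
      Module.finrank ℂ σ.toSubmodule = m :=
    ⟨_, ⊤, by
      change (⊤ : Submodule ℂ W) ≠ ⊥
      exact top_ne_bot, rfl⟩
  obtain ⟨σ, hσ, hσm⟩ := Nat.find_spec hex
  have hmin : ∀ τ : Subrepresentation π, τ.toSubmodule ≠ ⊥ →
      Module.finrank ℂ σ.toSubmodule ≤ Module.finrank ℂ τ.toSubmodule := by
    intro τ hτ
    rw [hσm]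
    exact Nat.find_min' hex ⟨τ, hτ, rfl⟩
  refine ⟨σ, hσ, ?_⟩
  -- irreducibility of the restriction
  have hbt : (⊥ : Submodule ℂ σ.toSubmodule) ≠ ⊤ := by
    intro h
    apply hσ
    rw [eq_bot_iff]
    intro x hx
    have : (⟨x, hx⟩ : σ.toSubmodule) ∈ (⊥ : Submodule ℂ σ.toSubmodule) := by rw [h]; trivial
    rw [Submodule.mem_bot] at this
    rw [Submodule.mem_bot]
    exact congrArg Subtype.val this
  haveI : Nontrivial (Subrepresentation σ.toRepresentation) :=
    ⟨⊥, ⊤, fun h => hbt (congrArg Subrepresentation.toSubmodule h)⟩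
  refine { eq_bot_or_eq_top := fun τ => ?_ }
  -- push `τ` forward to a subrepresentation of `π` inside `σ`
  let τ' : Subrepresentation π :=
    ⟨τ.toSubmodule.map σ.toSubmodule.subtype, by
      intro g v hv
      obtain ⟨x, hx, rfl⟩ := Submodule.mem_map.mp hv
      refine Submodule.mem_map.mpr ⟨σ.toRepresentation g x, τ.apply_mem_toSubmodule g hx, ?_⟩
      rfl⟩
  by_cases hτ : τ.toSubmodule = ⊥
  · left
    exact Subrepresentation.toSubmodule_injective hτ
  · right
    have hτ' : τ'.toSubmodule ≠ ⊥ := by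
      intro h
      apply hτ
      have h2 : τ.toSubmodule.map σ.toSubmodule.subtype = ⊥ := h
      exact Submodule.map_injective_of_injective (Submodule.injective_subtype σ.toSubmodule)
        (h2.trans (Submodule.map_bot _).symm)
    have hle := hmin τ' hτ'
    have heq : Module.finrank ℂ τ'.toSubmodule = Module.finrank ℂ τ.toSubmodule :=
      LinearEquiv.finrank_eq (Submodule.equivMapOfInjective _ (Submodule.injective_subtype _) _).symm
    rw [heq] at hle
    have htop : τ.toSubmodule = ⊤ :=
      Submodule.eq_top_of_finrank_eq (le_antisymm (Submodule.finrank_le _) hle)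
    exact Subrepresentation.toSubmodule_injective htop

end Summit.ValiantsHypothesis.ValiantsHypothesis.Theorems.SymPencilEquivariantSdcNotQP.YoungBounds

end
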